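/-
Copyright (c) 2026 the pub-hodgecm-mathlib formalisation cell (harness21).  Prover seat hodgecm-mathlib-R90-C10-p05 (g3), R90-TF SLAB section S1 «Ch10-local», (S-W) line lead,
card (W-3b) (self-dealt as line lead 2026-09-05T03:41Z, sibling of ★ (W-3) p865143 `R90S1WildConcaveLevelDatumRa`): U4Keys :182 WILD corner (S-W), sub-branch (R-b)
«`χ₁` NON-trivial on the `σ`-fixed units» — the PRODUCTIVE cell of R90-C10-p02 (g3)'s partition (`CENSUS-SW-firstbrick.v1.md` f6499a1e §4), letter `HWRb` of record
(R-S1-38): A θ-MULTIPLICATIVE CONCAVE (TWO-DEPTH) LEVEL DATUM `(⌊n∕2⌋, δ; ⌈n∕2⌉, δ + 1)` EXISTS — the tame Branch-B datum `(ν, 0; ν, 1)` SHIFTED BY THE DEFECT.  MODEL level,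
THEOREMS ONLY, hypothesis-first over ★ (O1) `K2E3ConcaveLevelIwahoriCharacterMin` (K2E3-p34 (g3)), ★ D174 `K2E3IwahoriTwoDepthFactorisation` (K2E3-p14 (g9)) and ★ (W-3).
NOT THE PAYER of :182 — the `hθmul` organ of `HWRb`'s producer (the wild determinant road), type side, first brick.
-/
import Summits.HodgeConjecture.HodgeConjecture.Theorems.R90S1WildConcaveLevelDatumRa           -- ★ (W-3) p865143 (this seat): `v_mul_pow_le_pow_of_defect` (defect letter ⇒ weighted letters); brings ★ (O1) `chi_apply_zero_zero_mul_of_concave_min` and ★ D174 `exists_subgroup_forall_mem_iff_twoDepth`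
import HarnessLib

/-!
# R90-TF S1 «Ch10-local» — U4Keys :182, THE WILD CORNER (S-W), sub-branch (R-b) (the productive cell, letter `HWRb`):
# A θ-MULTIPLICATIVE TWO-DEPTH LEVEL DATUM `e = (⌊n∕2⌋, δ; ⌈n∕2⌉, δ + 1)` EXISTS — «`r + r' = n`, `(s, s') = (δ, δ + 1)`, `θ(j) := χ₁(j₀₀)` multiplicative on `J_e`»
# [Tits1979 §1.15; BruhatTits1972 §6.4, (6.4.9); Roche1998 §3; MoyPrasad1996 §3; Serre1979 III §3, V §3]

Cell hodgecm-mathlib, R90-TF SLAB (HUMAN RULING «R90-TF SLAB — MAX PUSH»), crux item H413 = `stmt-HodgeConjecture-24833` (route `HCCMUnconditional`, no route verbs);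
serves BY NAME the OPEN tier-0 socket (S-W) `…K2E3EllipticInputs.U4Keys.sig_K2E3KeysThmTwoContractingRamifiedCharOnePosDepthWild` (organ ED. 12 :270) through its cell letter
`HWRb` of record (R-S1-38; head ★∕cand (W-5) `R90S1KeysThmTwoPosDepthWildLeafOfRecord`): Branch B (`χ₁ ∘ N = 1` on units), `χ₁` NON-trivial on the `σ`-fixed units of modulus one
(`hFε`), `i(χ₁, 1)` reducible ⟹ the ROOT `χ₁(σΠ·Π) = ‖σΠ·Π‖^{1∕2}`.  Its producer is the WILD DETERMINANT ROAD (the twin of S1's tame chain ★ (B-0)…(8⁺c)) and this file is that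
road's FIRST type-side organ: the `hθmul` letter.  Author R90-C10-p05 (g3).  `--supports stmt-HodgeConjecture-24833 --as helper`; THEOREMS ONLY (no `def` ∕ `instance` ∕ `notation`
∕ named fact ∕ `sorry`); MODEL level = ★ (O1) §4's frame VERBATIM; `t ht htmin` and the defect `hδ : |t|·|ϖ|^δ ≤ 1` are LETTERS (discharged at a place by ★ (W-0) p865099
`exists_traceOne_min` and R90-C10-p01 (g4)'s bridge `R90S1WildTraceMinDefect`); the (R-b) conductor facts are LETTERS here (`hcondF` at level `c`, `c ≤ 2δ + 1`, `2δ + 1 ≤ n`) and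
★ BY NAME on the CM side (★ (W-2) p865073 `R90S1WildUnitNormIndex.apply_eq_one_of_fixed_of_valued_sub_one_le` — conductor of `χ₁|U_F` is `≤ d`, i.e. `hcondF` at `E`-level `2d − 1 = 2δ + 1`;
`…exists_fixed_near_one_apply_eq_neg_one` — a fixed `u ≡ 1 (ϖ^{2δ})` with `χ₁ u = −1`, whence cond_E `χ₁ = n ≥ 2δ + 1`).  NOT THE PAYER of :182 and NOT a type theorem (flag below).

THE POINT.  ★ (O1) §4 `chi_apply_zero_zero_mul_of_concave_min` makes `θ(j) := χ₁(j₀₀)` multiplicative on D174's `J_e`, `e = ![![0,r,s],![r',0,r],![s',r',0]]`, under `n ≤ r + r'`,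
`c ≤ s + s'` and the two `|t|`-WEIGHTED inequalities, which the defect letter turns into `n + δ ≤ s + 2r'`, `n + δ ≤ s' + 2r` (★ (W-3) `v_mul_pow_le_pow_of_defect`; §2 here states
★ (O1) §4 in that DEFECT currency for a general `σ`-fixed level `c` — ★ (W-3) §2 is its `c := 1` instance).  With Roche's `r + r' = n` these read `s ≥ (r − r') + δ`, `s' ≥ (r' − r) + δ`;
in (R-b) the `σ`-fixed level is `c = 2δ + 1`, so `s + s' ≥ 2δ + 1`, and D174's concavity `s ≤ 2r`, `s' ≤ 2r'` caps `s + s' ≤ 2n`.  The MINIMAL solution (largest group) is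
  `r := ⌊n∕2⌋`, `r' := ⌈n∕2⌉`, `s := δ`, `s' := δ + 1`   — concave IFF `δ + 1 ≤ n` (§1, pure `omega`, both parities), and the level constraint `c = 2δ + 1 ≤ s + s'`
holds with equality; in (R-b) `n ≥ 2δ + 1 (≥ δ + 1)` is AUTOMATIC (the near-one witness), which is the hypothesis §3 binds.  At `δ = 0` this is EXACTLY the tame Branch-B datum `(ν, 0; ν, 1)` of ★ (8) ∕ ★ (B-6) (`ν + ν = m + 1`, F-slot `k = 0`):
the wild determinant road keeps the tame SHAPE and shifts the long-root depths by the defect `δ = d − 1` [Tits1979 §1.15].  K2E3-p34 (g3)'s census (a) l.22–23 («closes iff … roughly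
`a_F ≥ d − 1`») and (c) l.51 («(R-b) sits EXACTLY at the threshold») are this file's §1 read at `a_F = d`.
* §1 `wildRb_exponents` — the explicit exponents and their (in)equalities (ℕ arithmetic; hypothesis `δ + 1 ≤ n`, exactly what concavity needs).
* §2 **`chi_apply_zero_zero_mul_of_fixCond_of_defect`** — ★ (O1) §4 in the defect currency, general `c` (the reusable head; (R-a) = ★ (W-3) §2 at `c := 1`).
* §3 **`exists_levelGroup_theta_mul_of_fixCond_of_defect`** — in (R-b) (`hcondF` at a level `c ≤ 2δ + 1`, `2δ + 1 ≤ n`): `∃ (r, s; r', s')`, `r + r' = n`, `s = δ`, `s' = δ + 1`, `1 ≤ r'`,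
  `∃ Jg` (D174's two-depth group) with `θ` multiplicative on `Jg`.
CONSUMER: the wild determinant road for `HWRb` — type basis (★ (B-1′) `R90S1BposBranchBTypeBasisTwoDepthCM`-shape, place-generic per p02 census §3), Bruhat cells (★ (B-2b)), a WILD
cell cover (new, M: K2E3-p34 (a) l.31–32 window closes at `k = 2δ`, which is (R-b)), then the analytic layer over ★ Literature `HeisenbergWildChartFibre`∕`…FibreHaar`∕`…LevelFibreVolume`
(LH4-p10) + ★ (W-2c) masses + P-wild-1's shell law ⟹ the root.  This file is the road's `hθmul` letter and nothing more.
HONEST FLAG.  θ-MULTIPLICATIVE ≠ TYPE: nothing here claims `dim i(χ₁,1)^{(J_e, θ)} = 2` (the wild cell ∕ witness cover is a separate, unbuilt brick); unlike (R-a) (★ (W-3)'s flag),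
in (R-b) the Z-witness family IS available (`hFε` supplies a `σ`-fixed `u₂` with `χ₁ u₂ ≠ 1` at level `2δ`) and K2E3-p34 (a) prices the cover twin at M — not done here.
HONEST LABEL: HC_CM is proved only modulo the 7 printed citations (2 remaining named inputs: hLiu418 = stmt-HodgeConjecture-24832, h413 = stmt-HodgeConjecture-24833)
until rung 0 closes; count-neutral — this file pays no socket and closes nothing; (S-W) stays the XL residual of :182 (its (R-b) cell L after the paper step P-wild-1); no
printed citation is discharged.

## References
* [Tits1979] J. Tits, *Reductive groups over local fields*, Proc. Sympos. Pure Math. 33.1 (1979), §1.15 (ramified quasi-split `SU₃`, the trace constant), §3.7.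
* [BruhatTits1972] F. Bruhat, J. Tits, *Groupes réductifs sur un corps local I*, Publ. Math. IHÉS 41 (1972), §6.4, (4.4.4), (6.4.9).
* [Roche1998] A. Roche, *Types and Hecke algebras for principal series representations of split reductive p-adic groups*, Ann. Sci. ÉNS (4) 31 (1998), §3 (`f_χ`, `J_χ`, Lemma 3.2).
* [MoyPrasad1996] A. Moy, G. Prasad, *Jacquet functors and unrefined minimal K-types*, Comment. Math. Helv. 71 (1996), §3.
* [Serre1979] J.-P. Serre, *Local Fields*, GTM 67 (1979), Ch. III §3 Prop. 7 (the defect `δ = d − 1`), Ch. V §3 Prop. 5 Cor. 3 (conductor of `ω_{E∕F}` is `d`).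
* [Keys1984] D. Keys, *Principal series representations of special unitary groups over local fields*, Compositio Math. 51 (1984), §7 Thm (2) (the (R-b) reducibility point).
-/

set_option autoImplicit false
-- the mandated namespace repeats the single-problem summit's segment (`HodgeConjecture.HodgeConjecture`)
set_option linter.dupNamespace false

noncomputable section

open Matrix Literature.NumberTheory.Automorphic Literature.NumberTheory.Automorphic.UnitaryGroup
open scoped Matrix MatrixGroups WithZero

namespace Summit.HodgeConjecture.HodgeConjecture.R90.S1.WildConcaveLevelDatumRb

open Summit.HodgeConjecture.HodgeConjecture.Cruxes.H413
open Summit.HodgeConjecture.HodgeConjecture.Cruxes.H413.K2E3ConcaveLevelIwahoriCharacterMin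
open Summit.HodgeConjecture.HodgeConjecture.Cruxes.H413.K2E3IwahoriTwoDepthFactorisation
open Summit.HodgeConjecture.HodgeConjecture.R90.S1.WildConcaveLevelDatumRa

/-! ## §1 The (R-b) exponents: `r + r' = n`, `(s, s') = (δ, δ + 1)`, concave, N̄-side positive, the two defect inequalities — solvable iff `2δ + 1 ≤ n` -/

/-- **THE (R-b)-WILD EXPONENTS = THE TAME BRANCH-B DATUM SHIFTED BY THE DEFECT.**  For `2δ + 1 ≤ n` the choice `r := ⌊n∕2⌋`, `r' := ⌈n∕2⌉`, `s := δ`, `s' := δ + 1` satisfies: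
Roche's short-root split `r + r' = n`; long-root total `s + s' = 2δ + 1` (the `σ`-fixed level of (R-b): conductor `d = δ + 1` of `χ₁|U_F` read in `E`-valuation); N̄-side positivity
`1 ≤ r'`, `1 ≤ s'`; D174's concavity `s ≤ 2r`, `s' ≤ 2r'`, `r ≤ s + r'`, `r' ≤ s' + r`; the two DEFECT inequalities `n + δ ≤ s + 2r'`, `n + δ ≤ s' + 2r`; and `r ≤ r' ≤ r + 1`.
The binding constraints are `s ≤ 2r ⟺ δ ≤ 2⌊n∕2⌋` and `s' ≤ 2r' ⟺ δ + 1 ≤ 2⌈n∕2⌉`, i.e. EXACTLY `δ + 1 ≤ n` (the hypothesis; the two defect inequalities hold for every `n`) —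
weaker than (R-b)'s automatic `2δ + 1 ≤ n`, which §3 binds for the `σ`-fixed level `c ≤ 2δ + 1 ≤ n`; at `δ = 0` the datum is the tame `(ν, 0; ν, 1)`.  (R90-C10-p07 (g3) cross-read.)
[cite: BruhatTits1972, §6.4, (6.4.9)] [cite: Roche1998, §3, Lemma 3.2] [cite: Tits1979, §1.15] [cite: Serre1979, Ch. V §3 Prop. 5 Cor. 3] -/
theorem wildRb_exponents {n δ : ℕ} (hn : δ + 1 ≤ n) :
    ∃ r s r' s' : ℕ, r + r' = n ∧ s = δ ∧ s' = δ + 1 ∧ 1 ≤ r' ∧ 1 ≤ s' ∧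
      s ≤ 2 * r ∧ s' ≤ 2 * r' ∧ r ≤ s + r' ∧ r' ≤ s' + r ∧
      n + δ ≤ s + 2 * r' ∧ n + δ ≤ s' + 2 * r ∧ r ≤ r' ∧ r' ≤ r + 1 := by
  refine ⟨n / 2, δ, n - n / 2, δ + 1, ?_, rfl, rfl, ?_, ?_, ?_, ?_, ?_, ?_, ?_, ?_, ?_, ?_⟩ <;> omega

/-! ## §2 The head: ★ (O1) §4 in the defect currency, general `σ`-fixed level `c` -/

section Model

variable {K : Type*} [Field K] [Valued K ℤᵐ⁰] [ValuativeRel K] [(Valued.v : Valuation K ℤᵐ⁰).Compatible]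
  (σ : K →+* K) {ϖ : K} {J : Matrix (Fin 3) (Fin 3) K} (hJ : J = (StdForm.antidiagonal 3).over K)
  (hσ : ∀ a, σ (σ a) = a) (hvσ : ∀ a, Valued.v (σ a) = Valued.v a) (hvϖ : Valued.v ϖ = WithZero.exp (-1 : ℤ))
  (e : Fin 3 → Fin 3 → ℕ) (Jg : Subgroup ↥(unitaryGroupOfForm σ J))
  (hJg : ∀ k : ↥(unitaryGroupOfForm σ J), k ∈ Jg ↔ ∀ i j, Valued.v (((k : GL (Fin 3) K) : Matrix (Fin 3) (Fin 3) K) i j) ≤ Valued.v ϖ ^ e i j)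

include hJ hσ hvσ hvϖ hJg in
/-- **THE HEAD — `θ(j) := χ₁(j₀₀)` IS MULTIPLICATIVE ON THE TWO-DEPTH GROUP `Jg`, MINIMAL-`t`-WITH-DEFECT FORM, GENERAL `σ`-FIXED LEVEL `c`.**  Exponent matrix `e` with `1 ≤ e 1 0`,
`1 ≤ e 2 0` and D174's membership letter `hJg`; `χ₁ : Kˣ → ℂˣ` trivial on `{u : |u − 1| ≤ |ϖ|ⁿ}` (cond_E `≤ n`) and on the `σ`-fixed `{u : σu = u, |u − 1| ≤ |ϖ|^c}` (`1 ≤ c`; in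
(R-b) `c = 2δ + 1` by ★ (W-2)); a MINIMAL trace-one `t` (`ht`, `htmin`) with DEFECT bound `hδ : |t|·|ϖ|^δ ≤ 1`; exponent inequalities `n ≤ e 0 1 + e 1 0`, `n + δ ≤ e 0 2 + 2·e 1 0`,
`n + δ ≤ e 2 0 + 2·e 0 1`, `c ≤ e 0 2 + e 2 0`.  Then `χ₁((jj′)₀₀) = χ₁(j₀₀)·χ₁(j′₀₀)` for `j, j′ ∈ Jg` — ONE application of ★ (O1) `chi_apply_zero_zero_mul_of_concave_min` with the two
weighted letters produced by ★ (W-3) `v_mul_pow_le_pow_of_defect`.  Conclusion and the `(e, Jg, hJg) hc1 hcond hcondF ht htmin h1 h4 hj hj′ h0 h10 h20` bytes are ★ (O1) §4's VERBATIM;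
★ (W-3) `chi_apply_zero_zero_mul_of_fixTrivial_of_defect` is the `c := 1` instance.  NOT a type theorem. [cite: Roche1998, §3] [cite: Tits1979, §1.15] [cite: MoyPrasad1996, §3]
[cite: BruhatTits1972, (6.4.9)] -/
theorem chi_apply_zero_zero_mul_of_fixCond_of_defect (h10e : 1 ≤ e 1 0) (h20e : 1 ≤ e 2 0) (χ₁ : Kˣ →* ℂˣ) {n c δ : ℕ} (hc1 : 1 ≤ c)
    (hcond : ∀ u : Kˣ, Valued.v ((u : K) - 1) ≤ Valued.v ϖ ^ n → χ₁ u = 1)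
    (hcondF : ∀ u : Kˣ, σ (u : K) = u → Valued.v ((u : K) - 1) ≤ Valued.v ϖ ^ c → χ₁ u = 1)
    {t : K} (ht : t + σ t = 1) (htmin : ∀ a : K, a + σ a = 1 → Valued.v t ≤ Valued.v a)
    (hδ : Valued.v t * Valued.v ϖ ^ δ ≤ 1)
    (h1 : n ≤ e 0 1 + e 1 0) (h2 : n + δ ≤ e 0 2 + 2 * e 1 0) (h3 : n + δ ≤ e 2 0 + 2 * e 0 1) (h4 : c ≤ e 0 2 + e 2 0)
    {j j' : ↥(unitaryGroupOfForm σ J)} (hj : j ∈ Jg) (hj' : j' ∈ Jg)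
    (h0 : (((j * j' : ↥(unitaryGroupOfForm σ J)) : GL (Fin 3) K) : Matrix (Fin 3) (Fin 3) K) 0 0 ≠ 0)
    (h10 : (((j : GL (Fin 3) K) : Matrix (Fin 3) (Fin 3) K) 0 0) ≠ 0) (h20 : (((j' : GL (Fin 3) K) : Matrix (Fin 3) (Fin 3) K) 0 0) ≠ 0) :
    χ₁ (Units.mk0 _ h0) = χ₁ (Units.mk0 _ h10) * χ₁ (Units.mk0 _ h20) :=
  chi_apply_zero_zero_mul_of_concave_min σ hJ hσ hvσ hvϖ e Jg hJg h10e h20e χ₁ hc1 hcond hcondF ht htmin h1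
    (v_mul_pow_le_pow_of_defect hvϖ hδ h2) (v_mul_pow_le_pow_of_defect hvϖ hδ h3) h4 hj hj' h0 h10 h20

/-! ## §3 Existence in (R-b): the datum `(⌊n∕2⌋, δ; ⌈n∕2⌉, δ + 1)` and its θ-multiplicative group -/

include hJ hσ hvσ hvϖ in
/-- **A θ-MULTIPLICATIVE CONCAVE LEVEL DATUM EXISTS IN SUB-BRANCH (R-b).**  For `χ₁` of cond_E `≤ n` trivial on the `σ`-fixed `{u : σu = u, |u − 1| ≤ |ϖ|^c}` with
`1 ≤ c ≤ 2δ + 1` (in (R-b): `c = 2d − 1`, ★ (W-2) `apply_eq_one_of_fixed_of_valued_sub_one_le`), a minimal trace-one `t` with `|t|·|ϖ|^δ ≤ 1`, and `2δ + 1 ≤ n` (in (R-b): automatic,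
★ (W-2) `exists_fixed_near_one_apply_eq_neg_one` ∕ ★ (W-2c) `two_mul_pred_add_one_le_of_cond`; only `δ + 1 ≤ n` is used for concavity, the rest bounds `c`): there are exponents `(r, s; r', s')` with `r + r' = n`, `s = δ`, `s' = δ + 1`, `1 ≤ r'` (§1) and a subgroup `Jg ≤ U(σ, Φ₃)` cut
out by the two-depth test for `e = ![![0, r, s], ![r', 0, r], ![s', r', 0]]` (★ D174 `exists_subgroup_forall_mem_iff_twoDepth`) on which `θ(j) := χ₁(j₀₀)` is multiplicative (§2).
The tame Branch-B datum is the case `δ = 0`.  NOT a type theorem (the wild cell cover is a separate brick).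
[cite: Roche1998, §3, Lemma 3.2] [cite: BruhatTits1972, §6.4, (6.4.9)] [cite: Tits1979, §1.15] [cite: MoyPrasad1996, §3] [cite: Keys1984, §7 Thm (2)] -/
theorem exists_levelGroup_theta_mul_of_fixCond_of_defect (χ₁ : Kˣ →* ℂˣ) {n c δ : ℕ} (hc1 : 1 ≤ c) (hcδ : c ≤ 2 * δ + 1) (hn : 2 * δ + 1 ≤ n)
    (hcond : ∀ u : Kˣ, Valued.v ((u : K) - 1) ≤ Valued.v ϖ ^ n → χ₁ u = 1)
    (hcondF : ∀ u : Kˣ, σ (u : K) = u → Valued.v ((u : K) - 1) ≤ Valued.v ϖ ^ c → χ₁ u = 1)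
    {t : K} (ht : t + σ t = 1) (htmin : ∀ a : K, a + σ a = 1 → Valued.v t ≤ Valued.v a)
    (hδ : Valued.v t * Valued.v ϖ ^ δ ≤ 1) :
    ∃ r s r' s' : ℕ, r + r' = n ∧ s = δ ∧ s' = δ + 1 ∧ 1 ≤ r' ∧
      ∃ Jg : Subgroup ↥(unitaryGroupOfForm σ J),
        (∀ k : ↥(unitaryGroupOfForm σ J), k ∈ Jg ↔ ∀ i j, Valued.v (((k : GL (Fin 3) K) : Matrix (Fin 3) (Fin 3) K) i j) ≤
          Valued.v ϖ ^ (![![0, r, s], ![r', 0, r], ![s', r', 0]] : Fin 3 → Fin 3 → ℕ) i j) ∧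
        ∀ (j j' : ↥(unitaryGroupOfForm σ J)), j ∈ Jg → j' ∈ Jg →
          ∀ (h0 : (((j * j' : ↥(unitaryGroupOfForm σ J)) : GL (Fin 3) K) : Matrix (Fin 3) (Fin 3) K) 0 0 ≠ 0)
            (h10 : (((j : GL (Fin 3) K) : Matrix (Fin 3) (Fin 3) K) 0 0) ≠ 0) (h20 : (((j' : GL (Fin 3) K) : Matrix (Fin 3) (Fin 3) K) 0 0) ≠ 0),
            χ₁ (Units.mk0 _ h0) = χ₁ (Units.mk0 _ h10) * χ₁ (Units.mk0 _ h20) := by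
  obtain ⟨r, s, r', s', hrr, hs, hs', hr', hs'1, hs2, hs'2, hrc, hr'c, h2, h3, -, -⟩ :=
    wildRb_exponents (show δ + 1 ≤ n by omega)
  obtain ⟨Jg, hJg⟩ := exists_subgroup_forall_mem_iff_twoDepth σ hJ hvσ hvϖ hs2 hs'2 hrc hr'c
  refine ⟨r, s, r', s', hrr, hs, hs', hr', Jg, hJg, fun j j' hj hj' h0 h10 h20 => ?_⟩
  exact chi_apply_zero_zero_mul_of_fixCond_of_defect σ hJ hσ hvσ hvϖ _ Jg hJg hr' hs'1 χ₁ hc1 hcond hcondF ht htmin hδ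
    (show n ≤ r + r' by omega) (show n + δ ≤ s + 2 * r' from h2) (show n + δ ≤ s' + 2 * r from h3) (show c ≤ s + s' by omega) hj hj' h0 h10 h20

end Model

end Summit.HodgeConjecture.HodgeConjecture.R90.S1.WildConcaveLevelDatumRb

end
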